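import Mathlib.LinearAlgebra.FiniteDimensional.Lemmas
import Mathlib.LinearAlgebra.Finsupp.LinearCombination
import Mathlib.LinearAlgebra.FreeModule.Finite.Matrix
import Literature.AlgebraicGeometry.Motives.FaltingsECSubspacesHomFactsProofs
import HarnessLib

/-!
# Faltings' Korollar 1 for `(E, E')` from the subspace statement alone: the dichotomy for `E_ℓ`

D-0014 keeps `Literature/` sorry-free by stating cited results as named facts `def X : Prop`.
This sibling of `Literature.AlgebraicGeometry.Motives.FaltingsECSubspacesHom` concerns the named
fact `Literature.Hodge.mem_span_range_tateModule_map_of_equivariant W W' ℓ`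
(`Literature.AlgebraicGeometry.Motives.FaltingsEC`) — the elliptic-curve case of G. Faltings,
*Endlichkeitssätze für abelsche Varietäten über Zahlkörpern*, Invent. Math. 73 (1983), §5,
Satz 4 with Korollar 1: for elliptic curves `E, E'` over a number field `K` and a prime `ℓ`, every
`Γ_K`-equivariant `ℤ_ℓ`-linear map `T_ℓ E → T_ℓ E'` is a `ℤ_ℓ`-linear combination of the maps
`T_ℓ φ`, `φ : E → E'` an isogeny defined over `K` (surjectivity of
`Hom_K(E, E') ⊗ ℤ_ℓ → Hom_{Γ_K}(T_ℓ E, T_ℓ E')`).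

`FaltingsECSubspacesHomFactsProofs` reduced this fact to **two** named facts:
`Literature.Hodge.stable_subspace_prod_eq_range_pair W W' ℓ` — Faltings' subspace assertion for the
abelian surface `A = E × E'` ("Theorem 4 applied to `A₁ × A₂`"), the deep input — and
`WeierstrassCurve.geomEndRing_comm` (Silverman, *AEC*, Cor. III.9.4: `End(E)` is commutative in
characteristic `0`), which the preludes cannot prove yet (it needs the invariant differential).
This file **removes the second input**: Korollar 1 for `(E, E')`, Korollar 2 for `(E, E')` and
Satz 4 for `E` now follow from Faltings' subspace assertion *alone*; every input from the
elementary theory of elliptic curves is a theorem of the tree.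

## The idea: `E_ℓ` is commutative or everything

Commutativity entered at one place. In the graph argument for a pair
(`Literature.AlgebraicGeometry.Motives.comp_mem_of_graph_eq_range_pair`, `FaltingsECSubspacesHomProofs`) the graph of an equivariant
`G : V_ℓ E → V_ℓ E'` is the image of `(a b; c d)`, and after composing with an isogeny
`ψ₀ : E' → E` one must place `Ψ G` (`Ψ = 1 ⊗ T_ℓ ψ₀`) in
`E_ℓ = image(End_K(E) ⊗ ℚ_ℓ) ⊆ End(V_ℓ E)` knowing `a, b Φ, Ψ c, Ψ d Φ ∈ E_ℓ`; this is the graph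
argument in dimension two (`Literature.AlgebraicGeometry.Motives.mem_of_graph_eq_range`), valid for a *commutative* `E_ℓ ∋ 1` and
false for the algebra of upper triangular matrices (module docstring of
`FaltingsECSubspacesHomFactsProofs`). But `E_ℓ` cannot be the upper triangular algebra. The unital
subalgebras of `M₂(ℚ_ℓ)` are the commutative ones, the conjugates of the upper triangular algebra
`B`, and `M₂(ℚ_ℓ)`; in `B` every commutator squares to zero, whereas in `E_ℓ` the commutator of
two generators `1 ⊗ T_ℓ φ`, `1 ⊗ T_ℓ ψ` is `1 ⊗ T_ℓ χ` for the `K`-endomorphism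
`χ = φ ψ - ψ φ`, and **a non-zero `K`-endomorphism of an elliptic curve acts invertibly on
`V_ℓ E`** — it is an isogeny (`End_K(E) = {0} ∪ {isogenies}`, the tree's
`WeierstrassCurve.mem_geomEndRing_iff_holds`) and has a dual `χ'` with `χ' χ = [deg χ]`
(`WeierstrassCurve.Isogeny.exists_dual_of_isElliptic`, *AEC* III.6.1(a), proved in the tree in
characteristic `0`). Hence (`rationalEndSpan_comm_or_eq_top`):

> for an elliptic curve `E` over a field of characteristic `0`, `E_ℓ` is commutative or
> `E_ℓ = End(V_ℓ E)`,

and in the second case `Ψ G ∈ E_ℓ` holds trivially. (By *AEC* III.9.4 the second case never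
occurs; the point is that the dichotomy is provable now, and suffices.) The linear algebra is
`Literature.AlgebraicGeometry.Motives.eq_top_of_mul_sub_mul_injective`: a subspace `A ⊆ End(V)`, `dim V = 2`, containing `1`,
closed under composition and containing `s, t` with `s t - t s` injective, is `End(V)` — no line
is `A`-stable (on it `s`, `t` would act by scalars); for `v ≠ 0` the evaluation `A → V` is onto;
if its kernel has dimension `≥ 2` then `dim A = 4`; if it is a line `F a₀` it is a left ideal and
the image of `a₀` is a stable line; if it is `0` then `dim A = 2` and `A = F + F s` is
commutative (`Literature.AlgebraicGeometry.Motives.mul_comm_of_finrank_le_two`).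

## Contents (all proved)

* `Literature.AlgebraicGeometry.Motives.mul_comm_of_finrank_le_two`, `Literature.AlgebraicGeometry.Motives.eq_top_of_mul_sub_mul_injective`: the linear algebra
  over any field.
* `Literature.AlgebraicGeometry.Motives.mul_mem_rationalEndSpan`: `E_ℓ` is closed under composition.
* `Literature.AlgebraicGeometry.Motives.baseChange_tateEndRingHom_injective`: `1 ⊗ T_ℓ χ` is injective on `V_ℓ E` for
  `χ ∈ End_K(E)`, `χ ≠ 0` (characteristic `0`, `E` elliptic).
* `Literature.AlgebraicGeometry.Motives.rationalEndSpan_comm_or_eq_top`: the dichotomy.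
* `Literature.AlgebraicGeometry.Motives.mem_span_baseChange_tateModule_map_of_subspaces_pair_of_dual`: the `ℚ_ℓ`-form of
  Korollar 1 for `(E, E')` from subspace realization for `E × E'` and the weak dual isogeny
  (`mem_span_baseChange_tateModule_map_of_subspaces_pair` without `hcomm`).
* `Literature.AlgebraicGeometry.Motives.mem_rationalHomSpan_of_equivariant_of_pair_fact`,
  `Literature.AlgebraicGeometry.Motives.mem_span_range_tateModule_map_of_equivariant_of_pair_fact`,
  `Literature.AlgebraicGeometry.Motives.isIsogenous_iff_exists_tateModule_hom_ne_zero_of_pair_fact`: the `ℚ_ℓ`-form of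
  Korollar 1, the named fact `mem_span_range_tateModule_map_of_equivariant W W' ℓ` (Korollar 1)
  and the named fact `isIsogenous_iff_exists_tateModule_hom_ne_zero W W' ℓ` (Korollar 2,
  (i) ⇔ (ii)) from the **single** named fact `stable_subspace_prod_eq_range_pair W W' ℓ`.
* `Literature.AlgebraicGeometry.Motives.mem_span_range_tateModule_map_of_equivariant_self_of_subspace_fact`,
  `Literature.AlgebraicGeometry.Motives.mem_span_range_tateEndRingHom_iff_of_subspace_fact`: Korollar 1 for `(E, E)` and the
  named fact `mem_span_range_tateEndRingHom_iff W ℓ` (Satz 4 for `E`, `End` form) from the single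
  named fact `stable_subspace_prod_eq_range W ℓ` of `FaltingsECSubspaces` (improving
  `mem_span_range_tateEndRingHom_iff_of_facts'` there, which also assumed `W.geomEndRing_comm`).

## State of the fact

With `FaltingsECSubspacesHomConverseProofs` (`stable_subspace_prod_eq_range_pair_of_faltings`: the
subspace assertion for `E × E'` follows from Satz 3 for `E`, `E'` and Korollar 1 for the four
pairs) the reduction is now tight: `mem_span_range_tateModule_map_of_equivariant W W' ℓ` ⟸
`stable_subspace_prod_eq_range_pair W W' ℓ` ⟸ Faltings' Sätze 3–4 with Korollar 1 for `E, E'`.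
What is *not* proved is Faltings' theorem itself for the abelian surface `E × E'` (Satz 1:
finiteness for bounded modular height; Satz 2: `h(A/G_n) = h(A)` via Tate–Raynaud and the
Hodge–Tate decomposition; Tate's lattice argument through the quotients `(E × E')/G_n`, abelian
surfaces which are not products of elliptic curves), a theory the tree does not have; see also
`Literature.AlgebraicGeometry.Motives.FaltingsECOfAbelianVarietyProofs` for the alternative
reduction to hodge.S27 for abelian varieties plus bridge data
(`WeierstrassCurve.nonempty_abelianVarietyBridge`).

## References

* [Faltings1983Endlichkeit] G. Faltings, Invent. Math. 73 (1983), 349–366, §5: Satz 4,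
  Korollar 1 ("Theorem 4 applied to `A₁ × A₂`"), Korollar 2; English translation
  [Faltings1986FinitenessTranslation], Cornell–Silverman (eds.), *Arithmetic Geometry* (1986),
  Ch. II, §5, Theorem 4, Corollaries 1–2.
* [SilvermanAEC2009] J. H. Silverman, *The Arithmetic of Elliptic Curves*, 2nd ed., GTM 106:
  III.§4 (`End(E)`), Thm. III.6.1(a) (dual isogeny), Thm. III.7.4, Cor. III.9.4 (statement).
* J. Tate, *Endomorphisms of abelian varieties over finite fields*, Invent. Math. 2 (1966),
  134–144, §2 (the graph argument).

## Design choices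

* `noncomputable section`; the linear algebra in `namespace Literature` over an arbitrary field `F`
  (any `V` with `finrank F V = 2`), the elliptic-curve statements in `namespace Literature.Hodge` with
  `K : Type u`, exactly as in the sibling files; no definitions, proofs only.
* The kernel of the evaluation map `A → V` is read inside `End(V)` (as `{b ∈ A | b v = 0}`,
  `Submodule.finrank_map_subtype_eq`) to keep typeclass search off iterated subtypes.
* Identities between base-changed Tate-module maps are proved in
  `Module.End ℚ_ℓ (ℚ_ℓ ⊗ T_ℓ E)` and moved to `V_ℓ E = W.rationalTateModule ℓ` by `change`, as in
  `FaltingsECEndomorphismsProofs`.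
-/

noncomputable section

namespace Literature.AlgebraicGeometry.Motives

section TwoDimAlgebra

open Module

variable {F V : Type*} [Field F] [AddCommGroup V] [Module F V]

/-- In a subspace `E ⊆ End(V)` of dimension at most two containing `1`, any two elements commute:
either `s` is a scalar, or `E = F + F s ∋ t`. [folklore] -/
theorem mul_comm_of_finrank_le_two {E : Submodule F (Module.End F V)}
    [FiniteDimensional F E]
    (h1 : (1 : Module.End F V) ∈ E) (hE : finrank F E ≤ 2) {s t : Module.End F V} (hs : s ∈ E)
    (ht : t ∈ E) : s * t = t * s := by
  by_cases hsc : ∃ c : F, s = c • 1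
  · obtain ⟨c, rfl⟩ := hsc
    rw [smul_mul_assoc, one_mul, mul_smul_comm, mul_one]
  · -- `1, s` are linearly independent, so they span `E`, and `t = p + q s`
    have hli : LinearIndependent F ![(1 : Module.End F V), s] := by
      refine LinearIndependent.pair_iff.mpr fun p q hpq ↦ ?_
      by_cases hq : q = 0
      · subst hq
        rw [zero_smul, add_zero] at hpq
        by_cases hp : p = 0
        · exact ⟨hp, rfl⟩
        · -- `p • 1 = 0` with `p ≠ 0` forces `1 = 0`, so `s = 0` is a scalar
          have h10 : (1 : Module.End F V) = 0 := by
            simpa [smul_smul, inv_mul_cancel₀ hp] using congrArg (fun z ↦ p⁻¹ • z) hpq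
          exact absurd ⟨0, by rw [zero_smul, ← mul_one s, h10, mul_zero]⟩ hsc
      · exact absurd ⟨-(q⁻¹ * p), by
          have : q • s = -(p • (1 : Module.End F V)) := eq_neg_of_add_eq_zero_right hpq
          calc s = q⁻¹ • (q • s) := by rw [smul_smul, inv_mul_cancel₀ hq, one_smul]
            _ = -(q⁻¹ * p) • 1 := by rw [this, smul_neg, smul_smul, neg_smul]⟩ hsc
    have hle : Submodule.span F (Set.range ![(1 : Module.End F V), s]) ≤ E := by
      rw [Submodule.span_le]
      rintro _ ⟨i, rfl⟩
      fin_cases i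
      · exact h1
      · exact hs
    have hspan : Submodule.span F (Set.range ![(1 : Module.End F V), s]) = E := by
      refine Submodule.eq_of_le_of_finrank_le hle ?_
      rw [finrank_span_eq_card hli, Fintype.card_fin]
      exact hE
    have ht' : t ∈ Submodule.span F (Set.range ![(1 : Module.End F V), s]) := hspan ▸ ht
    obtain ⟨c, hc⟩ := (Submodule.mem_span_range_iff_exists_fun (R := F)).mp ht'
    rw [Fin.sum_univ_two] at hc
    simp only [Matrix.cons_val_zero, Matrix.cons_val_one] at hc
    rw [← hc, mul_add, add_mul, smul_mul_assoc, one_mul, mul_smul_comm, mul_one, smul_mul_assoc,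
      mul_smul_comm]

/-- **A non-commutative unital subalgebra of `End(V)`, `dim V = 2`, containing two elements with
injective commutator is all of `End(V)`.** Let `E ⊆ End(V)` be a subspace containing `1` and
closed under composition, and `s, t ∈ E` with `s t - t s` injective. Then no line `L ⊆ V` is
`E`-stable (on a stable line `s`, `t` act by scalars, so `s t - t s` kills it); for `v ≠ 0` the
evaluation `E → V`, `a ↦ a v`, is therefore onto (its image is `E`-stable and contains `v`). If
its kernel has dimension `≥ 2` then `dim E ≥ 4 = dim End(V)`. If the kernel is a line `F a₀`, it
is a left ideal, so `b a₀ ∈ F a₀` for all `b ∈ E` and the image of `a₀ ≠ 0` is a stable line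
(`a₀ v = 0`, so `a₀` is not onto) — impossible. If the kernel is `0` then `dim E = 2` and `E` is
commutative (`mul_comm_of_finrank_le_two`), contradicting the injectivity of `s t - t s ≠ 0`.
(Equivalently: the proper subalgebras of `M₂(F)` are commutative or conjugate to the upper
triangular matrices, whose commutators square to zero.) [folklore] -/
theorem eq_top_of_mul_sub_mul_injective (h2 : finrank F V = 2)
    {E : Submodule F (Module.End F V)} (h1 : (1 : Module.End F V) ∈ E)
    (hmul : ∀ a ∈ E, ∀ b ∈ E, a * b ∈ E) {s t : Module.End F V} (hs : s ∈ E) (ht : t ∈ E)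
    (hu : Function.Injective (s * t - t * s)) : E = ⊤ := by
  haveI : FiniteDimensional F V := Module.finite_of_finrank_eq_succ h2
  haveI : Nontrivial V := Module.nontrivial_of_finrank_eq_succ h2
  have h4 : finrank F (Module.End F V) = 4 := by
    rw [Module.finrank_linearMap, h2]
  -- (A) no `E`-stable subspace other than `⊥` and `⊤`
  have hirr : ∀ L : Submodule F V, (∀ a ∈ E, ∀ x ∈ L, a x ∈ L) → L = ⊥ ∨ L = ⊤ := by
    intro L hL
    by_contra hne
    obtain ⟨hbot, htop⟩ := not_or.mp hne
    have hL1 : finrank F L = 1 := by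
      have hlt : finrank F L < 2 := h2 ▸ Submodule.finrank_lt htop
      have hpos : finrank F L ≠ 0 := fun h ↦ hbot (Submodule.finrank_eq_zero.mp h)
      omega
    obtain ⟨x, hxL, hx0⟩ := Submodule.exists_mem_ne_zero_of_ne_bot hbot
    have hgen := (finrank_eq_one_iff_of_nonzero' (⟨x, hxL⟩ : L)
      (fun h ↦ hx0 (congrArg Subtype.val h))).mp hL1
    obtain ⟨c, hc⟩ := hgen ⟨s x, hL s hs x hxL⟩
    obtain ⟨d, hd⟩ := hgen ⟨t x, hL t ht x hxL⟩
    have hc' : s x = c • x := by simpa using (congrArg Subtype.val hc).symm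
    have hd' : t x = d • x := by simpa using (congrArg Subtype.val hd).symm
    have hux : (s * t - t * s) x = 0 := by
      rw [LinearMap.sub_apply, Module.End.mul_apply, Module.End.mul_apply, hd', map_smul, hc',
        map_smul, hd', smul_smul, smul_smul, mul_comm, sub_self]
    exact hx0 (hu (by rw [hux, map_zero]))
  -- `s t - t s ≠ 0`, so `E` is not commutative
  have hst : s * t ≠ t * s := by
    intro hcomm
    obtain ⟨v, hv⟩ := exists_ne (0 : V)
    refine hv (hu ?_)
    rw [map_zero, LinearMap.sub_apply, hcomm, sub_self]
  by_contra hne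
  have hlt : finrank F E < 4 := h4 ▸ Submodule.finrank_lt hne
  -- (B) the evaluation map at `v ≠ 0` is onto
  obtain ⟨v, hv⟩ := exists_ne (0 : V)
  set ev : E →ₗ[F] V := (LinearMap.applyₗ v).comp E.subtype with hev
  have hev_apply : ∀ a : E, ev a = (a : Module.End F V) v := fun a ↦ rfl
  have hrange : LinearMap.range ev = ⊤ := by
    refine (hirr (LinearMap.range ev) ?_).resolve_left ?_
    · rintro b hb _ ⟨a, rfl⟩
      exact ⟨⟨b * a, hmul b hb a a.2⟩, rfl⟩
    · intro hbot
      have : v ∈ LinearMap.range ev := ⟨⟨1, h1⟩, rfl⟩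
      rw [hbot, Submodule.mem_bot] at this
      exact hv this
  have hrn := LinearMap.finrank_range_add_finrank_ker ev
  rw [hrange, finrank_top, h2] at hrn
  -- (C) the kernel has dimension `0` or `1`
  have hker : finrank F (LinearMap.ker ev) = 0 ∨ finrank F (LinearMap.ker ev) = 1 := by omega
  rcases hker with hk0 | hk1
  · -- `dim E = 2`: `E` is commutative
    have hE2 : finrank F E ≤ 2 := by omega
    exact hst (mul_comm_of_finrank_le_two h1 hE2 hs ht)
  · -- `ker = F a₀` is a left ideal; the image of `a₀` is a stable line
    -- (the kernel is read inside `End(V)` as `K₁ = {b ∈ E | b v = 0}`)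
    set K₁ : Submodule F (Module.End F V) := (LinearMap.ker ev).map E.subtype with hK₁
    have hK₁f : finrank F K₁ = 1 := by
      rw [hK₁, Submodule.finrank_map_subtype_eq]
      exact hk1
    have hmemK₁ : ∀ b, b ∈ K₁ ↔ b ∈ E ∧ b v = 0 := fun b ↦ by
      simp only [hK₁, Submodule.mem_map, LinearMap.mem_ker, Submodule.coe_subtype]
      constructor
      · rintro ⟨a, ha, rfl⟩
        exact ⟨a.2, ha⟩
      · rintro ⟨hb, hbv⟩
        exact ⟨⟨b, hb⟩, hbv, rfl⟩
    obtain ⟨a₀, ha₀, hgen⟩ := (finrank_eq_one_iff' (K := F) (V := K₁)).mp hK₁f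
    set A : Module.End F V := (a₀ : Module.End F V) with hA
    have hAE : A ∈ E := ((hmemK₁ A).mp a₀.2).1
    have hAv : A v = 0 := ((hmemK₁ A).mp a₀.2).2
    have hA0 : A ≠ 0 := fun h ↦ ha₀ (Subtype.ext h)
    have hleft : ∀ b ∈ E, ∃ c : F, b * A = c • A := by
      intro b hb
      have hbA : b * A ∈ K₁ := by
        refine (hmemK₁ _).mpr ⟨hmul b hb A hAE, ?_⟩
        rw [Module.End.mul_apply, hAv, map_zero]
      obtain ⟨c, hc⟩ := hgen ⟨_, hbA⟩
      exact ⟨c, by simpa [hA] using (congrArg Subtype.val hc).symm⟩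
    have hstab : ∀ b ∈ E, ∀ y ∈ LinearMap.range A, b y ∈ LinearMap.range A := by
      rintro b hb _ ⟨x, rfl⟩
      obtain ⟨c, hc⟩ := hleft b hb
      refine ⟨c • x, ?_⟩
      rw [map_smul, ← LinearMap.smul_apply, ← hc, Module.End.mul_apply]
    rcases hirr _ hstab with hbot | htop
    · exact hA0 (LinearMap.range_eq_bot.mp hbot)
    · have hsurj : Function.Surjective A := LinearMap.range_eq_top.mp htop
      have hinj : Function.Injective A := LinearMap.injective_iff_surjective.mpr hsurj
      exact hv (hinj (by rw [hAv, map_zero]))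

end TwoDimAlgebra

end Literature.AlgebraicGeometry.Motives

universe u

namespace Literature.AlgebraicGeometry.Motives

open WeierstrassCurve

open scoped TensorProduct

variable {K : Type u} [Field K] (W W' : WeierstrassCurve K) (ℓ : ℕ) [Fact ℓ.Prime]

/-- `E_ℓ` is closed under composition: the generators `1 ⊗ T_ℓ φ`, `φ ∈ End_K(E)`, multiply by
`(1 ⊗ T_ℓ φ)(1 ⊗ T_ℓ ψ) = 1 ⊗ T_ℓ(φ ψ)` (`tateEndRingHom` is a ring homomorphism). [folklore] -/
theorem mul_mem_rationalEndSpan {s t : Module.End ℚ_[ℓ] (W.rationalTateModule ℓ)}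
    (hs : s ∈ rationalEndSpan W ℓ) (ht : t ∈ rationalEndSpan W ℓ) :
    s * t ∈ rationalEndSpan W ℓ := by
  induction hs using Submodule.span_induction generalizing t with
  | mem s hsS =>
    induction ht using Submodule.span_induction with
    | mem t htS =>
      obtain ⟨φ, rfl⟩ := hsS
      obtain ⟨ψ, rfl⟩ := htS
      refine Submodule.subset_span ⟨φ * ψ, ?_⟩
      change LinearMap.baseChange ℚ_[ℓ] (tateEndRingHom W ℓ (φ * ψ)) =
        (LinearMap.baseChange ℚ_[ℓ] (tateEndRingHom W ℓ φ) *
          LinearMap.baseChange ℚ_[ℓ] (tateEndRingHom W ℓ ψ) :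
            Module.End ℚ_[ℓ] (ℚ_[ℓ] ⊗[ℤ_[ℓ]] W.tateModule ℓ))
      rw [map_mul, LinearMap.baseChange_mul]
    | zero => rw [mul_zero]; exact Submodule.zero_mem _
    | add t t' _ _ h h' => rw [mul_add]; exact Submodule.add_mem _ h h'
    | smul c t _ h => rw [mul_smul_comm]; exact Submodule.smul_mem _ c h
  | zero => rw [zero_mul]; exact Submodule.zero_mem _
  | add s s' _ _ h h' => rw [add_mul]; exact Submodule.add_mem _ (h ht) (h' ht)
  | smul c s _ h => rw [smul_mul_assoc]; exact Submodule.smul_mem _ c (h ht)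

/-- **A non-zero `K`-endomorphism acts invertibly on `V_ℓ E`** (characteristic `0`, `E`
elliptic): for `χ ∈ End_K(E)`, `χ ≠ 0`, the map `1 ⊗ T_ℓ χ` of `V_ℓ E` is injective. Indeed `χ`
is an isogeny `E → E` over `K` (`End_K(E) = {0} ∪ {isogenies}`: the tree's
`WeierstrassCurve.mem_geomEndRing_iff_holds` through `eq_zero_or_exists_isogeny_of_mem_endRing`),
it has a dual `χ'` with `χ' ∘ χ = [n]`, `n = deg χ ≠ 0` (`Isogeny.exists_dual_of_isElliptic`,
Silverman, *AEC*, III.6.1), and `(1 ⊗ T_ℓ χ') ∘ (1 ⊗ T_ℓ χ) = n` is injective on the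
`ℚ_ℓ`-space `V_ℓ E`. [cite: SilvermanAEC2009, Thm. III.6.1(a) with III.7] -/
theorem baseChange_tateEndRingHom_injective [CharZero K] [W.IsElliptic] {χ : W.endRing}
    (hχ : χ ≠ 0) : Function.Injective ((tateEndRingHom W ℓ χ).baseChange ℚ_[ℓ]) := by
  rcases eq_zero_or_exists_isogeny_of_mem_endRing W (mem_geomEndRing_iff_holds W) χ.2 with
    h0 | ⟨χ₁, hχ₁⟩
  · exact absurd (Subtype.ext h0) hχ
  · obtain ⟨χ', hχ'⟩ := χ₁.exists_dual_of_isElliptic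
    have hn : ((χ₁.degree : ℕ) : ℚ_[ℓ]) ≠ 0 := Nat.cast_ne_zero.mpr χ₁.degree_pos.ne'
    have hcomp := baseChange_tateModule_map_comp_eq_smul ℓ (φ := χ') (ψ := χ₁) hχ'
    have hT : tateEndRingHom W ℓ χ = Literature.NumberTheory.EllipticCurves.TateModule.map ℓ χ₁.toAddMonoidHom := by
      rw [tateEndRingHom_apply, ← hχ₁]
    rw [hT]
    intro x y hxy
    have := congrArg ((Literature.NumberTheory.EllipticCurves.TateModule.map ℓ χ'.toAddMonoidHom).baseChange ℚ_[ℓ] :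
      W.rationalTateModule ℓ →ₗ[ℚ_[ℓ]] W.rationalTateModule ℓ) hxy
    rw [← LinearMap.comp_apply, ← LinearMap.comp_apply, hcomp, LinearMap.smul_apply,
      LinearMap.smul_apply, LinearMap.id_apply, LinearMap.id_apply] at this
    exact smul_right_injective _ hn this

/-- **The dichotomy for `E_ℓ`** (characteristic `0`, `E` elliptic): the image
`E_ℓ ⊆ End(V_ℓ E)` of `End_K(E) ⊗ ℚ_ℓ` is **either commutative or all of `End(V_ℓ E)`**. If two
generators `1 ⊗ T_ℓ φ`, `1 ⊗ T_ℓ ψ` (`φ, ψ ∈ End_K(E)`) do not commute, their commutator is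
`1 ⊗ T_ℓ χ` with `χ = φ ψ - ψ φ ≠ 0` in `End_K(E)`, which is injective on `V_ℓ E`
(`baseChange_tateEndRingHom_injective`: a non-zero endomorphism is an isogeny and has a dual);
a unital subalgebra of `End(V)`, `dim V = 2`, containing two elements with injective commutator
is `End(V)` (`Literature.AlgebraicGeometry.Motives.eq_top_of_mul_sub_mul_injective`). (In fact `End_K(E)` is commutative in
characteristic `0`, Silverman, *AEC*, III.9.4, and the second case does not occur; the dichotomy
is what the graph argument for Faltings' Korollar 1 needs, and it avoids III.9.4.)
[cite: SilvermanAEC2009, Thm. III.6.1(a)] -/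
theorem rationalEndSpan_comm_or_eq_top [CharZero K] [W.IsElliptic] :
    (∀ s ∈ rationalEndSpan W ℓ, ∀ t ∈ rationalEndSpan W ℓ, s * t = t * s) ∨
      rationalEndSpan W ℓ = ⊤ := by
  by_cases hgen : ∀ φ ψ : W.endRing,
      (LinearMap.baseChange ℚ_[ℓ] (tateEndRingHom W ℓ φ) *
          LinearMap.baseChange ℚ_[ℓ] (tateEndRingHom W ℓ ψ) :
            Module.End ℚ_[ℓ] (ℚ_[ℓ] ⊗[ℤ_[ℓ]] W.tateModule ℓ)) =
        LinearMap.baseChange ℚ_[ℓ] (tateEndRingHom W ℓ ψ) *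
          LinearMap.baseChange ℚ_[ℓ] (tateEndRingHom W ℓ φ)
  · left
    intro s hs t ht
    refine commute_of_mem_span_of_pairwise ?_ hs ht
    rintro _ ⟨φ, rfl⟩ _ ⟨ψ, rfl⟩
    exact hgen φ ψ
  · right
    obtain ⟨φ, hgen⟩ := not_forall.mp hgen
    obtain ⟨ψ, hne⟩ := not_forall.mp hgen
    have hℓK : ((ℓ : ℕ) : K) ≠ 0 := Nat.cast_ne_zero.mpr (Fact.out : ℓ.Prime).ne_zero
    have h2 : Module.finrank ℚ_[ℓ] (W.rationalTateModule ℓ) = 2 :=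
      finrank_rationalTateModule_eq_two_holds W ℓ hℓK
    -- the commutator is `1 ⊗ T_ℓ (φ ψ - ψ φ)` with `φ ψ - ψ φ ≠ 0`
    have hχ : φ * ψ - ψ * φ ≠ 0 := by
      intro h0
      apply hne
      rw [← sub_eq_zero, ← LinearMap.baseChange_mul, ← LinearMap.baseChange_mul, ← map_mul,
        ← map_mul, ← LinearMap.baseChange_sub, ← map_sub, h0, map_zero, LinearMap.baseChange_zero]
    refine eq_top_of_mul_sub_mul_injective h2 (one_mem_rationalEndSpan W ℓ)
      (fun a ha b hb ↦ mul_mem_rationalEndSpan W ℓ ha hb)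
      (baseChange_tateEndRingHom_mem_rationalEndSpan W ℓ φ)
      (baseChange_tateEndRingHom_mem_rationalEndSpan W ℓ ψ) ?_
    change Function.Injective ⇑((LinearMap.baseChange ℚ_[ℓ] (tateEndRingHom W ℓ φ) *
          LinearMap.baseChange ℚ_[ℓ] (tateEndRingHom W ℓ ψ) -
        LinearMap.baseChange ℚ_[ℓ] (tateEndRingHom W ℓ ψ) *
          LinearMap.baseChange ℚ_[ℓ] (tateEndRingHom W ℓ φ) :
            Module.End ℚ_[ℓ] (ℚ_[ℓ] ⊗[ℤ_[ℓ]] W.tateModule ℓ)))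
    rw [← LinearMap.baseChange_mul, ← LinearMap.baseChange_mul, ← map_mul, ← map_mul,
      ← LinearMap.baseChange_sub, ← map_sub]
    exact baseChange_tateEndRingHom_injective W ℓ hχ


/-! ## The `ℚ_ℓ`-form of Korollar 1 for `(E, E')` without the commutativity input -/

/-- **The `ℚ_ℓ`-form of Faltings' Korollar 1 for `(E, E')` from subspace realization for
`E × E'` and the dual isogeny alone.** Let `E, E'` be elliptic curves over a number field `K` and
`ℓ` a prime. Assume (`hX`) that every `ℚ_ℓ`-subspace of `V_ℓ E × V_ℓ E'` stable under the diagonal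
action of `Γ_K` is the image of an endomorphism `(a b; c d)` with `a ∈ E_ℓ`, `b ∈ H_ℓ(E', E)`,
`c ∈ H_ℓ(E, E')`, `d ∈ E'_ℓ` (Faltings' assertion "`W` is the image of an idempotent in
`End_K(A) ⊗ ℚ_ℓ`" for the abelian surface `A = E × E'`), and (`hdual`) that every isogeny
`ψ : E' → E` over `K` has a partner `φ : E → E'` with `φ ∘ ψ = [n]`, `n ≠ 0`. Then every
`Γ_K`-equivariant `ℚ_ℓ`-linear `G : V_ℓ E → V_ℓ E'` lies in `H_ℓ(E, E')`. This is
`mem_span_baseChange_tateModule_map_of_subspaces_pair` (`FaltingsECSubspacesHomProofs`) with its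
hypothesis `hcomm : W.geomEndRing_comm` (*AEC* III.9.4) **removed**: commutativity of `E_ℓ` was
used only to place `Ψ G` in `E_ℓ` by the graph argument for a pair
(`Literature.AlgebraicGeometry.Motives.comp_mem_of_graph_eq_range_pair`), and by the dichotomy `rationalEndSpan_comm_or_eq_top`
either `E_ℓ` is commutative, or `E_ℓ = End(V_ℓ E) ∋ Ψ G` trivially. The rest of the proof is
unchanged: `hX` applied to the graph of `G` gives `c = G a`, `d = G b`, `a V + b V' = V`; with no
isogeny `E' → E`, `b = 0`, `a` is invertible with `a⁻¹ ∈ E_ℓ` and `G = c a⁻¹`; otherwise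
`G = n⁻¹ Φ (Ψ G) ∈ Φ E_ℓ ⊆ H_ℓ(E, E')` for `Φ = 1 ⊗ T_ℓ φ₁`, `Ψ = 1 ⊗ T_ℓ ψ₀`, `φ₁ ∘ ψ₀ = [n]`.
Faltings 1983, §5, Satz 4 with Korollar 1; Tate, Invent. Math. 2 (1966), §2.
[cite: Faltings1983Endlichkeit, §5, Satz 4, Korollar 1 (proof: "Theorem 4 applied to A₁ × A₂")] -/
theorem mem_span_baseChange_tateModule_map_of_subspaces_pair_of_dual [NumberField K]
    [W.IsElliptic] [W'.IsElliptic]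
    (hX : ∀ U : Submodule ℚ_[ℓ] (W.rationalTateModule ℓ × W'.rationalTateModule ℓ),
      (∀ (σ : Field.absoluteGaloisGroup K) (v : W.rationalTateModule ℓ × W'.rationalTateModule ℓ),
        v ∈ U → (rationalGaloisRepTate W ℓ σ v.1, rationalGaloisRepTate W' ℓ σ v.2) ∈ U) →
      ∃ (a : Module.End ℚ_[ℓ] (W.rationalTateModule ℓ))
        (b : W'.rationalTateModule ℓ →ₗ[ℚ_[ℓ]] W.rationalTateModule ℓ)
        (c : W.rationalTateModule ℓ →ₗ[ℚ_[ℓ]] W'.rationalTateModule ℓ)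
        (d : Module.End ℚ_[ℓ] (W'.rationalTateModule ℓ)),
        a ∈ rationalEndSpan W ℓ ∧
        b ∈ Submodule.span ℚ_[ℓ] (Set.range (fun ψ : Isogeny W' W ↦
          (Literature.NumberTheory.EllipticCurves.TateModule.map ℓ ψ.toAddMonoidHom).baseChange ℚ_[ℓ]) :
            Set (W'.rationalTateModule ℓ →ₗ[ℚ_[ℓ]] W.rationalTateModule ℓ)) ∧
        c ∈ Submodule.span ℚ_[ℓ] (Set.range (fun φ : Isogeny W W' ↦
          (Literature.NumberTheory.EllipticCurves.TateModule.map ℓ φ.toAddMonoidHom).baseChange ℚ_[ℓ]) :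
            Set (W.rationalTateModule ℓ →ₗ[ℚ_[ℓ]] W'.rationalTateModule ℓ)) ∧
        d ∈ rationalEndSpan W' ℓ ∧
        U = LinearMap.range ((a.coprod b).prod (c.coprod d)))
    (hdual : ∀ ψ : Isogeny W' W, ∃ (φ : Isogeny W W') (n : ℕ), n ≠ 0 ∧
      ∀ Q, φ (ψ Q) = (n : ℤ) • Q)
    (G : W.rationalTateModule ℓ →ₗ[ℚ_[ℓ]] W'.rationalTateModule ℓ)
    (hG : ∀ (σ : Field.absoluteGaloisGroup K) (v : W.rationalTateModule ℓ),
      G (rationalGaloisRepTate W ℓ σ v) = rationalGaloisRepTate W' ℓ σ (G v)) :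
    G ∈ Submodule.span ℚ_[ℓ] (Set.range (fun φ : Isogeny W W' ↦
      (Literature.NumberTheory.EllipticCurves.TateModule.map ℓ φ.toAddMonoidHom).baseChange ℚ_[ℓ]) :
        Set (W.rationalTateModule ℓ →ₗ[ℚ_[ℓ]] W'.rationalTateModule ℓ)) := by
  have hℓK : ((ℓ : ℕ) : K) ≠ 0 := Nat.cast_ne_zero.mpr (Fact.out : ℓ.Prime).ne_zero
  have h2 : Module.finrank ℚ_[ℓ] (W.rationalTateModule ℓ) = 2 :=
    finrank_rationalTateModule_eq_two_holds W ℓ hℓK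
  obtain ⟨a, b, c, d, ha, hb, hc, hd, hU⟩ := hX _ (graph_stable_of_equivariant_pair ℓ hG)
  obtain ⟨hkey, hsurj⟩ := forall_of_graph_eq_range hU
  by_cases hne : Nonempty (Isogeny W' W)
  · -- an isogeny `ψ₀ : E' → E` and its partner `φ₁ : E → E'`, `φ₁ ∘ ψ₀ = [n]`
    obtain ⟨ψ₀⟩ := hne
    obtain ⟨φ₁, n, hn, hφψ⟩ := hdual ψ₀
    have hn' : (n : ℚ_[ℓ]) ≠ 0 := Nat.cast_ne_zero.mpr hn
    have hΦΨ := baseChange_tateModule_map_comp_eq_smul ℓ hφψ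
    -- `Ψ G ∈ E_ℓ`: by the graph argument if `E_ℓ` is commutative, trivially if `E_ℓ = End`
    have hΨG : ((Literature.NumberTheory.EllipticCurves.TateModule.map ℓ ψ₀.toAddMonoidHom).baseChange ℚ_[ℓ] :
          W'.rationalTateModule ℓ →ₗ[ℚ_[ℓ]] W.rationalTateModule ℓ) ∘ₗ G ∈
        rationalEndSpan W ℓ := by
      rcases rationalEndSpan_comm_or_eq_top W ℓ with hEcomm | htop
      · exact comp_mem_of_graph_eq_range_pair h2 (one_mem_rationalEndSpan W ℓ) hEcomm hn' hΦΨ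
          ha (comp_mem_rationalEndSpan_of_mem_span ℓ φ₁ hb)
          (comp_mem_rationalEndSpan_of_mem_span' ℓ ψ₀ hc)
          (comp_comp_mem_rationalEndSpan_of_mem ℓ ψ₀ φ₁ hd) hU
      · exact Submodule.eq_top_iff'.mp htop _
    -- `G = n⁻¹ Φ (Ψ G)`
    have hGeq : G = (n : ℚ_[ℓ])⁻¹ •
        (((Literature.NumberTheory.EllipticCurves.TateModule.map ℓ φ₁.toAddMonoidHom).baseChange ℚ_[ℓ] :
            W.rationalTateModule ℓ →ₗ[ℚ_[ℓ]] W'.rationalTateModule ℓ) ∘ₗ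
          (((Literature.NumberTheory.EllipticCurves.TateModule.map ℓ ψ₀.toAddMonoidHom).baseChange ℚ_[ℓ] :
              W'.rationalTateModule ℓ →ₗ[ℚ_[ℓ]] W.rationalTateModule ℓ) ∘ₗ G)) := by
      rw [← LinearMap.comp_assoc, hΦΨ, LinearMap.smul_comp, LinearMap.id_comp, smul_smul,
        inv_mul_cancel₀ hn', one_smul]
    rw [hGeq]
    refine Submodule.smul_mem _ _ ?_
    exact comp_mem_span_of_mem_span_of_mem_rationalEndSpan ℓ
      (Submodule.subset_span ⟨φ₁, rfl⟩) hΨG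
  · -- no isogeny `E' → E`: `b = 0`, `a` is invertible and `G = c a⁻¹`
    have hb0 : b = 0 := by
      haveI : IsEmpty (Isogeny W' W) := not_nonempty_iff.mp hne
      rw [Set.range_eq_empty, Submodule.span_empty] at hb
      exact (Submodule.mem_bot ℚ_[ℓ]).mp hb
    haveI : FiniteDimensional ℚ_[ℓ] (W.rationalTateModule ℓ) := Module.finite_of_finrank_eq_succ h2
    have hrange : LinearMap.range a = ⊤ := LinearMap.range_eq_top.mpr fun v ↦ by
      obtain ⟨x, y, hxy⟩ := hsurj v
      rw [hb0, LinearMap.zero_apply, add_zero] at hxy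
      exact ⟨x, hxy⟩
    obtain ⟨u, hu⟩ := (LinearMap.isUnit_iff_range_eq_top a).mpr hrange
    have hinv : a * ↑u⁻¹ = 1 := by rw [← hu, Units.mul_inv]
    have hinv' : ↑u⁻¹ * a = 1 := by rw [← hu, Units.inv_mul]
    have ha' : (↑u⁻¹ : Module.End ℚ_[ℓ] (W.rationalTateModule ℓ)) ∈ rationalEndSpan W ℓ :=
      comp_mem_of_comp_eq_one h2 (one_mem_rationalEndSpan W ℓ) ha hinv hinv'
    have hca : ∀ x, c x = G (a x) := fun x ↦ by
      simpa [hb0] using hkey x 0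
    have hGeq : G = c ∘ₗ (↑u⁻¹ : Module.End ℚ_[ℓ] (W.rationalTateModule ℓ)) := by
      refine LinearMap.ext fun v ↦ ?_
      rw [LinearMap.comp_apply, hca]
      exact congrArg G (LinearMap.congr_fun hinv v).symm
    rw [hGeq]
    exact comp_mem_span_of_mem_span_of_mem_rationalEndSpan ℓ hc ha'

/-! ## Korollar 1, Korollar 2 and Satz 4 from the subspace statement alone -/

variable {W W'} in
/-- **The `ℚ_ℓ`-form of Faltings' Korollar 1 for `(E, E')` from one named fact.** For elliptic
curves `E, E'` over a number field `K` and a prime `ℓ`, granted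
`stable_subspace_prod_eq_range_pair W W' ℓ` (Faltings 1983, §5, Sätze 3–4 for `A = E × E'`),
every `Γ_K`-equivariant `ℚ_ℓ`-linear map `V_ℓ E → V_ℓ E'` lies in `H_ℓ(E, E')`
(`rationalHomSpan W W' ℓ`), i.e. `Hom_K(E, E') ⊗ ℚ_ℓ → Hom_{Γ_K}(V_ℓ E, V_ℓ E')` is onto:
`mem_span_baseChange_tateModule_map_of_subspaces_pair_of_dual` with the dual isogeny supplied by
`exists_dual_weak_of_numberField` (`Isogeny.exists_dual_of_isElliptic`, *AEC* III.6.1(a), proved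
in the tree). [cite: Faltings1983Endlichkeit, §5, Satz 4, Korollar 1] -/
theorem mem_rationalHomSpan_of_equivariant_of_pair_fact
    (hX : stable_subspace_prod_eq_range_pair W W' ℓ) [NumberField K] [W.IsElliptic]
    [W'.IsElliptic] {G : W.rationalTateModule ℓ →ₗ[ℚ_[ℓ]] W'.rationalTateModule ℓ}
    (hG : ∀ (σ : Field.absoluteGaloisGroup K) (v : W.rationalTateModule ℓ),
      G (rationalGaloisRepTate W ℓ σ v) = rationalGaloisRepTate W' ℓ σ (G v)) :
    G ∈ rationalHomSpan W W' ℓ :=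
  mem_span_baseChange_tateModule_map_of_subspaces_pair_of_dual W W' ℓ (fun U hU ↦ hX U hU)
    (exists_dual_weak_of_numberField W W') G hG

/-- **Faltings' Korollar 1 for `(E, E')` from one named fact.** For Weierstrass curves `W, W'`
over `K` and a prime `ℓ`, the named fact `mem_span_range_tateModule_map_of_equivariant W W' ℓ`
(for `E, E'` elliptic over a number field, every `Γ_K`-equivariant `ℤ_ℓ`-linear map
`T_ℓ E → T_ℓ E'` is a `ℤ_ℓ`-combination of the `T_ℓ φ`, `φ : E → E'` an isogeny over `K`:
Faltings 1983, §5, Satz 4, Korollar 1, the surjectivity of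
`Hom_K(E, E') ⊗ ℤ_ℓ → Hom_{Γ_K}(T_ℓ E, T_ℓ E')`) follows from the **single** named fact
`stable_subspace_prod_eq_range_pair W W' ℓ` — Faltings' subspace assertion for the abelian
surface `E × E'`, the "Theorem 4 applied to `A₁ × A₂`" of the printed proof. The `ℚ_ℓ`-form is
`mem_rationalHomSpan_of_equivariant_of_pair_fact`; the descent to `ℤ_ℓ` (clearing denominators,
saturation of `ℤ_ℓ · {T_ℓ φ}` by Tate's Lemma 1) is
`mem_span_range_tateModule_map_of_equivariant_of_rational` (`FaltingsECSubspacesHomProofs`) with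
*AEC* III.4.11 supplied by its discharge
`Isogeny.exists_eq_comp_nsmul_of_geomTorsion_le_ker_holds W W'`. Compared with
`mem_span_range_tateModule_map_of_equivariant_of_pair_facts'` (`FaltingsECSubspacesHomFactsProofs`),
the hypothesis `W.geomEndRing_comm` (*AEC* III.9.4) is gone: every input from the elementary
theory of elliptic curves is now proved in the tree.
[cite: Faltings1983Endlichkeit, §5, Satz 4, Korollar 1 ("Theorem 4 applied to A₁ × A₂")] -/
theorem mem_span_range_tateModule_map_of_equivariant_of_pair_fact
    (hX : stable_subspace_prod_eq_range_pair W W' ℓ) :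
    mem_span_range_tateModule_map_of_equivariant W W' ℓ :=
  mem_span_range_tateModule_map_of_equivariant_of_rational W W' ℓ
    (fun _ hG ↦ mem_rationalHomSpan_of_equivariant_of_pair_fact ℓ hX hG)
    (Isogeny.exists_eq_comp_nsmul_of_geomTorsion_le_ker_holds W W')

/-- **Faltings' Korollar 2 for `(E, E')` from one named fact**: the named fact
`isIsogenous_iff_exists_tateModule_hom_ne_zero W W' ℓ` (elliptic curves over a number field are
isogenous over `K` iff they admit a non-zero `Γ_K`-equivariant `ℤ_ℓ`-linear map `T_ℓ E → T_ℓ E'`;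
Faltings 1983, §5, Korollar 2, (i) ⇔ (ii)) follows from `stable_subspace_prod_eq_range_pair W W' ℓ`
alone, through Korollar 1 (`mem_span_range_tateModule_map_of_equivariant_of_pair_fact`) and the
tree's `isIsogenous_iff_exists_tateModule_hom_ne_zero_of_satz4` (`FaltingsECIsogenyProofs`).
[cite: Faltings1983Endlichkeit, §5, Satz 4, Korollar 1, Korollar 2 (i)⇔(ii)] -/
theorem isIsogenous_iff_exists_tateModule_hom_ne_zero_of_pair_fact
    (hX : stable_subspace_prod_eq_range_pair W W' ℓ) :
    isIsogenous_iff_exists_tateModule_hom_ne_zero W W' ℓ :=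
  isIsogenous_iff_exists_tateModule_hom_ne_zero_of_satz4 W W' ℓ
    (mem_span_range_tateModule_map_of_equivariant_of_pair_fact W W' ℓ hX)

/-- **Faltings' Korollar 1 for `(E, E)` from the one-curve subspace statement**: the named fact
`mem_span_range_tateModule_map_of_equivariant W W ℓ` follows from
`stable_subspace_prod_eq_range W ℓ` of `FaltingsECSubspaces` (Faltings' subspace assertion for
`A = E × E`) alone, via `stable_subspace_prod_eq_range_pair_self_of` (`H_ℓ(E, E) = E_ℓ`).
[cite: Faltings1983Endlichkeit, §5, Satz 4, Korollar 1] -/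
theorem mem_span_range_tateModule_map_of_equivariant_self_of_subspace_fact
    (hX : stable_subspace_prod_eq_range W ℓ) :
    mem_span_range_tateModule_map_of_equivariant W W ℓ := by
  intro _ _ _
  exact mem_span_range_tateModule_map_of_equivariant_of_pair_fact W W ℓ
    (stable_subspace_prod_eq_range_pair_self_of W ℓ hX)

/-- **Faltings' Satz 4 for an elliptic curve from the subspace statement alone.** The named fact
`mem_span_range_tateEndRingHom_iff W ℓ` (`End_K(E) ⊗ ℤ_ℓ → End_{Γ_K}(T_ℓ E)` is onto, for `E`
elliptic over a number field: Faltings 1983, §5, Satz 4) follows from the **single** named fact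
`stable_subspace_prod_eq_range W ℓ` (`FaltingsECSubspaces`: every `Γ_K`-stable `ℚ_ℓ`-subspace of
`V_ℓ E × V_ℓ E` is the image of some `(a b; c d) ∈ M₂(E_ℓ)` — Faltings' assertion "`W` is the
image of an idempotent in `End_K(A) ⊗ ℚ_ℓ`" for `A = E × E`), through Korollar 1 for `(E, E)`
(`mem_span_range_tateModule_map_of_equivariant_self_of_subspace_fact`) and
`mem_span_range_tateEndRingHom_iff_of_hom` (`FaltingsECEndomorphismsProofs`). Compared with
`mem_span_range_tateEndRingHom_iff_of_facts'` (`FaltingsECSubspaces`), the hypothesis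
`W.geomEndRing_comm` (*AEC* III.9.4) is gone. [cite: Faltings1983Endlichkeit, §5, Satz 4 (proof)] -/
theorem mem_span_range_tateEndRingHom_iff_of_subspace_fact
    (hX : stable_subspace_prod_eq_range W ℓ) : mem_span_range_tateEndRingHom_iff W ℓ :=
  mem_span_range_tateEndRingHom_iff_of_hom W ℓ
    (mem_span_range_tateModule_map_of_equivariant_self_of_subspace_fact W ℓ hX)


end Literature.AlgebraicGeometry.Motives
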